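import Summits.BirchSwinnertonDyer.BirchSwinnertonDyer.Theorems.AlignedTransportAtTwoMainConjectureOfRankZeroBSDAtTwoZpTowerChevalleyGrowth
import Literature.NumberTheory.NumberFields.AmbiguousClassGenusLowerBound
import Literature.NumberTheory.IwasawaTheory.FukudaRankCountingLemmas
import HarnessLib

/-!
# Route `AlignedTransportAtTwo`, crux C2 `MainConjectureOfRankZeroBSDAtTwo` (stmt-BirchSwinnertonDyer-22298):
# GENUS THEORY IN RANK FORM ALONG A `ℤ_p`-TOWER, ANY PRIME `p` — `m·n ≤ n·rank_p Cl(K_n) + n + n·u_K + log_p #μ(K)` for `m` primes of `K` ramified in `K_n`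
# when every ramified prime is totally ramified from layer `0`

HONEST FRAMING (cell `bsd-f1-sign2`, WIDTH-5 attached prover seat `bsd-line-att-p3` gen 27, line `birth`, lead `bsd-line-att-p2`; `--supports`
stmt-BirchSwinnertonDyer-22298, closes nothing; BSD is NOT proved; crux C2, its verdict and every registered stub untouched).  THEOREMS ONLY — no definition, no
named fact, no `sorry`.  The odd-`p` twin (successor (e) of this seat's g26 memo, (a) of the g27 memo `GENUS-RANK-att-p3-g27.md`) of
`…SexticTowerRank.mul_le_mul_classGroupPRank_layer_add` (p756164, `p = 2`, `√2 ∈ K_1`): here `p` is any prime and the ramification input is Fukuda's index `0`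
(`TotallyRamifiedFrom κ 0`: every inertia group of `K_∞/K` is trivial or surjects onto `Gal(K_∞/K)`), so that a prime of `K` ramified in `K_n` has index exactly
`pⁿ` there.  Ingredients: this seat's lower genus bound `AmbiguousClass.finprod_ramificationIdxIn_le` (p755814: `∏ e_𝔭 ≤ [Cl(K_n):Cl(K_n)^{pⁿ}·I_σ]·pⁿ·[E_K:E_K ∩ N]`),
`AmbiguousClass.card_quotient_le_index_range_pow_pow` (a quotient killed by `pⁿ` has order `≤ [B:B^p]ⁿ`), Dirichlet's `[E_K : E_K^{pⁿ}] = p^k`, `k ≤ n·u + log_p #μ`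
(g25 `…ZpTowerChevalleyGrowth.exists_relIndex_map_pow_eq_pow`), the inertia dichotomy in the layers (tree `ZpExtension.inertia_layer_eq_bot_or_forall_mem`) and
Mathlib's `Ideal.card_inertia_eq_ramificationIdxIn`.

* §1 **`ramificationIdxIn_layer_eq_pow_of_ne_one`** — `TotallyRamifiedFrom κ 0`, `w` a prime of `K` ramified in `K_n` ⟹ `e(w, K_n/K) = pⁿ`;
  **`pow_dvd_finprod_ramificationIdxIn_layer_of_totallyRamifiedFrom`** — `m ≤ #{w ramified in K_n}` ⟹ `p^{mn} ∣ ∏_𝔭 e_𝔭(K_n/K)`.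
* §2 `index_range_pow_layer_eq_prime_pow` (`[Cl(K_n):Cl(K_n)^p] = p^{rank_p}`), ★ **`mul_le_mul_classGroupPRank_layer_add_of_totallyRamifiedFrom`** —
  **`m·n ≤ n·rank_p Cl(K_n) + n + n·u_K + log_p #μ(K)`** for every `n`; reading with `log_p #μ(K) = c`: `rank_p Cl(K_n) ≥ m − 1 − u − ⌊c/n⌋`-type bounds,
  spelled out as `le_classGroupPRank_layer_add_of_log_le` (`log_p #μ(K) ≤ c`, `n ≥ c + 1` ⟹ `m ≤ rank_p Cl(K_n) + 1 + u_K`).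
USE (cells bsd-potss / bsd-2adic, `p = 3, 5`): a `p`-RANK certificate `r_n = r_{n+1}` (Fukuda Thm. 1 (2)) or the small-rank door L10 (`rank_p Cl(K_{n+j}) < p^j − 1`)
can only hold where these lower bounds allow; e.g. `K` with `m` totally ramified `p`-adic places, `ζ_p ∉ K` (`log_p #μ = 0` for `p` odd unless `μ_p ⊂ K`):
`rank_p Cl(K_n) ≥ m − 1 − u_K` for every `n ≥ 1`.  No class group is computed here.
References: [Gras2003] IV.4; [Lang1990] Ch. 13 §4 L4.1–4.2; [Washington1997] §13.1 Lemma 13.3, §13.3 Prop. 13.22–13.23; [Fukuda1994] Thm. 1, p. 264;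
[NeukirchANT1999] Ch. I §9 Prop. (9.6).
-/

set_option linter.dupNamespace false
set_option autoImplicit false

noncomputable section
open scoped Classical NumberField nonZeroDivisors
namespace Summit.BirchSwinnertonDyer.BirchSwinnertonDyer.Theorems.AlignedTransportAtTwoZpTowerRankAnyPrime

open NumberField IsDedekindDomain
open Literature.NumberTheory.NumberFields Literature.NumberTheory.NumberFields.AmbiguousClass
  Literature.NumberTheory.NumberFields.AmbiguousIdeal Literature.NumberTheory.GaloisRepresentations
  Literature.NumberTheory.GaloisRepresentations.Herbrand Literature.NumberTheory.GaloisRepresentations.MinkowskiUnit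
  Literature.NumberTheory.GaloisRepresentations.CyclicNormIndex Literature.NumberTheory.IwasawaTheory
  Literature.NumberTheory.EllipticCurves
  Summit.BirchSwinnertonDyer.BirchSwinnertonDyer.Theorems.AlignedTransportAtTwoCubicTowerGrowth
  Summit.BirchSwinnertonDyer.BirchSwinnertonDyer.Theorems.AlignedTransportAtTwoZpTowerChevalleyGrowth

variable {K : Type} [Field K] [NumberField K] {p : ℕ} [hp : Fact p.Prime]

/-! ## §1 Total ramification at every layer from Fukuda's index `0`, any `p` -/

/-- **`e(w, K_n/K) = pⁿ` for a prime `w` of `K` RAMIFIED in `K_n`, when every inertia group of `K_∞/K` is trivial or everything** (`TotallyRamifiedFrom κ 0`):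
a prime `Q ∣ w` of `K_n` has `e(Q ∣ w) = e(w, K_n/K) ≠ 1`, so by the inertia dichotomy (tree `ZpExtension.inertia_layer_eq_bot_or_forall_mem`) its inertia
group is all of `Gal(K_n/K)`, of order `pⁿ = #I(Q) = e(w, K_n/K)` (Mathlib `Ideal.card_inertia_eq_ramificationIdxIn`).  Any prime `p`; the `p = 2`, `√2 ∈ K_1`
form is g25's `ramificationIdxIn_layer_eq_pow_of_sq_eq_two`. [cite: Washington1997, §13.1 Lemma 13.3 and Prop. 13.2] [cite: NeukirchANT1999, Ch. I §9 Prop. (9.6)] -/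
theorem ramificationIdxIn_layer_eq_pow_of_ne_one (κ : ZpExtension K p) (hram : TotallyRamifiedFrom κ 0) (n : ℕ)
    {w : HeightOneSpectrum (𝓞 K)}
    (hw : haveI : FiniteDimensional K (κ.layer n) := κ.finiteDimensional_layer_holds n
      w.asIdeal.ramificationIdxIn (𝓞 (κ.layer n)) ≠ 1) :
    haveI : FiniteDimensional K (κ.layer n) := κ.finiteDimensional_layer_holds n
    w.asIdeal.ramificationIdxIn (𝓞 (κ.layer n)) = p ^ n := by
  haveI : FiniteDimensional K (κ.layer n) := κ.finiteDimensional_layer_holds n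
  haveI : IsGalois K (κ.layer n) := κ.isGalois_layer_holds n
  haveI : NumberField (κ.layer n) := NumberField.of_module_finite K _
  haveI : w.asIdeal.IsPrime := w.isPrime
  haveI : w.asIdeal.IsMaximal := w.isMaximal
  obtain ⟨⟨Q, hQprime, hQover⟩⟩ :=
    (inferInstance : Nonempty (Ideal.primesOver w.asIdeal (𝓞 (κ.layer n))))
  haveI := hQprime
  haveI := hQover
  have hQ0 : Q ≠ ⊥ := Ideal.ne_bot_of_liesOver_of_ne_bot w.ne_bot Q
  haveI hQmax : Q.IsMaximal := hQprime.isMaximal hQ0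
  haveI : Module.Finite (𝓞 K) (𝓞 (κ.layer n)) := IsIntegralClosure.finite (𝓞 K) K (κ.layer n) (𝓞 (κ.layer n))
  haveI : IsGaloisGroup ((κ.layer n) ≃ₐ[K] (κ.layer n)) (𝓞 K) (𝓞 (κ.layer n)) :=
    IsGaloisGroup.of_isFractionRing _ (𝓞 K) (𝓞 (κ.layer n)) K (κ.layer n)
  have hcard := Ideal.card_inertia_eq_ramificationIdxIn (G := (κ.layer n) ≃ₐ[K] (κ.layer n)) w.asIdeal Q
  rcases κ.inertia_layer_eq_bot_or_forall_mem hram le_rfl (Nat.zero_le n) Q with h0 | hall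
  · exfalso
    rw [h0, Subgroup.card_bot] at hcard
    exact hw hcard.symm
  · have htop : Q.inertia ((κ.layer n) ≃ₐ[K] (κ.layer n)) = ⊤ := by
      rw [eq_top_iff]
      intro g _
      refine hall g fun x hx => ?_
      rw [κ.layer_zero] at hx
      obtain ⟨c, hc⟩ := IntermediateField.mem_bot.mp hx
      have hxc : x = algebraMap K (κ.layer n) c := Subtype.ext hc.symm
      rw [hxc, AlgEquiv.commutes]
    rw [htop, Subgroup.card_top, IsGalois.card_aut_eq_finrank, κ.finrank_layer_holds n] at hcard
    exact hcard.symm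

/-- **`p^{mn} ∣ ∏_𝔭 e_𝔭(K_n/K)` for `m ≤ #{primes of K ramified in K_n}`**, under `TotallyRamifiedFrom κ 0` (each ramified prime contributes exactly `pⁿ`).
[cite: Washington1997, §13.1 Lemma 13.3] [cite: Lang1990, Ch. 13 §4, proof of Lemma 4.2] -/
theorem pow_dvd_finprod_ramificationIdxIn_layer_of_totallyRamifiedFrom (κ : ZpExtension K p) (hram : TotallyRamifiedFrom κ 0) (n : ℕ) {m : ℕ}
    (hm : haveI : FiniteDimensional K (κ.layer n) := κ.finiteDimensional_layer_holds n
      m ≤ {w : HeightOneSpectrum (𝓞 K) | w.asIdeal.ramificationIdxIn (𝓞 (κ.layer n)) ≠ 1}.ncard) :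
    haveI : FiniteDimensional K (κ.layer n) := κ.finiteDimensional_layer_holds n
    p ^ (m * n) ∣ ∏ᶠ v : HeightOneSpectrum (𝓞 K), v.asIdeal.ramificationIdxIn (𝓞 (κ.layer n)) := by
  classical
  haveI : FiniteDimensional K (κ.layer n) := κ.finiteDimensional_layer_holds n
  haveI : IsGalois K (κ.layer n) := κ.isGalois_layer_holds n
  haveI : NumberField (κ.layer n) := NumberField.of_module_finite K _
  set f : HeightOneSpectrum (𝓞 K) → ℕ := fun v => v.asIdeal.ramificationIdxIn (𝓞 (κ.layer n)) with hf
  have hT := finite_setOf_ramificationIdxIn_ne_one (K := K) (L := κ.layer n)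
  set T := {v : HeightOneSpectrum (𝓞 K) | v.asIdeal.ramificationIdxIn (𝓞 (κ.layer n)) ≠ 1} with hTdef
  have hfT : ∀ w ∈ T, f w = p ^ n := fun w hw => ramificationIdxIn_layer_eq_pow_of_ne_one κ hram n hw
  have hsupp : Function.mulSupport f ⊆ ↑hT.toFinset := fun v hv => by
    rw [Set.Finite.coe_toFinset]; exact hv
  rw [finprod_eq_prod_of_mulSupport_subset f hsupp]
  have hprod : ∏ v ∈ hT.toFinset, f v = p ^ (n * T.ncard) := by
    rw [Finset.prod_congr rfl (fun v hv => hfT v ((Set.Finite.mem_toFinset hT).mp hv)), Finset.prod_const,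
      ← Set.ncard_eq_toFinset_card T hT, ← pow_mul]
  rw [hprod]
  refine pow_dvd_pow p ?_
  rw [mul_comm]
  exact Nat.mul_le_mul_left n hm

/-! ## §2 The tower in RANK form, any `p` -/

/-- `[Cl(K_n) : Cl(K_n)^p] = p ^ rank_p Cl(K_n)` (the tree's `classGroupPRank` currency). [cite: Fukuda1994, p. 264 (definition of `rank(M)`)] -/
theorem index_range_pow_layer_eq_prime_pow (κ : ZpExtension K p) (n : ℕ) :
    (powMonoidHom p : ClassGroup (𝓞 (κ.layer n)) →* ClassGroup (𝓞 (κ.layer n))).range.index = p ^ classGroupPRank κ n := by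
  haveI : FiniteDimensional K (κ.layer n) := κ.finiteDimensional_layer_holds n
  haveI : NumberField (κ.layer n) := NumberField.of_module_finite K _
  obtain ⟨c, hc⟩ := index_range_powMonoidHom_eq_prime_pow (K := ↥(κ.layer n)) p
  rw [classGroupPRank_def, ← Subgroup.index_eq_card, hc, padicValNat.prime_pow]

/-- ★ **THE `ℤ_p`-TOWER IN RANK FORM, ANY PRIME `p`.**  `κ` a `ℤ_p`-extension of the number field `K` with Fukuda index `0` (`TotallyRamifiedFrom κ 0`),
`m` at most the number of primes of `K` ramified in `K_n`:

  **`m·n ≤ n · rank_p Cl(K_n) + n + n·u_K + log_p #μ(K)`.**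

Proof: `p^{mn} ∣ ∏ e_𝔭(K_n/K)` (§1) `≤ [Cl(K_n) : Cl(K_n)^{pⁿ}·I_σ] · pⁿ · [E_K : E_K ∩ N]` (lower genus bound with Chevalley, p755814);
`[E_K : E_K ∩ N] ∣ [E_K : E_K^{pⁿ}] = p^k`, `k ≤ n·u + log_p #μ` (Dirichlet, p751162); `#(Cl(K_n)/(Cl^{pⁿ}·I_σ)) ≤ [Cl(K_n):Cl(K_n)^p]ⁿ = p^{n·rank_p}` (p755814).
[cite: Gras2003, IV.4] [cite: Lang1990, Ch. 13 §4, Lemma 4.1–4.2] [cite: Washington1997, §13.3 Prop. 13.22–13.23] -/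
theorem mul_le_mul_classGroupPRank_layer_add_of_totallyRamifiedFrom (κ : ZpExtension K p) (hram : TotallyRamifiedFrom κ 0) (n : ℕ) {m : ℕ}
    (hm : haveI : FiniteDimensional K (κ.layer n) := κ.finiteDimensional_layer_holds n
      m ≤ {w : HeightOneSpectrum (𝓞 K) | w.asIdeal.ramificationIdxIn (𝓞 (κ.layer n)) ≠ 1}.ncard) :
    m * n ≤ n * classGroupPRank κ n + (n + n * Units.rank K + Nat.log p (Units.torsionOrder K)) := by
  haveI : FiniteDimensional K (κ.layer n) := κ.finiteDimensional_layer_holds n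
  haveI : IsGalois K (κ.layer n) := κ.isGalois_layer_holds n
  haveI : NumberField (κ.layer n) := NumberField.of_module_finite K _
  haveI : IsCyclic ((κ.layer n) ≃ₐ[K] (κ.layer n)) := by
    obtain ⟨ψ, -, hker, -⟩ := κ.exists_cyclicCharacter_layer n
    exact isCyclic_of_cyclicLayer ψ (κ.layer n) hker
  have hp1 : 1 < p := hp.out.one_lt
  have hp0 : 0 < p := hp.out.pos
  have hdeg : Module.finrank K (κ.layer n) = p ^ n := κ.finrank_layer_holds n
  obtain ⟨σ, hσ⟩ := IsCyclic.exists_generator (α := (κ.layer n) ≃ₐ[K] (κ.layer n))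
  set L := ↥(κ.layer n)
  set X := ((powMonoidHom (Module.finrank K L) : ClassGroup (𝓞 L) →* ClassGroup (𝓞 L)).range ⊔
        ((ClassGroup.mulEquiv (intAut σ)).toMonoidHom / MonoidHom.id (ClassGroup (𝓞 L))).range).index with hX
  set U := (unitsE L ⊓ (⊤ : Subgroup Lˣ).map (Herbrand.norm (L ≃ₐ[K] L))).relIndex (unitsE L ⊓ (unitsIncl K L).range) with hU
  set E := (∏ᶠ v : HeightOneSpectrum (𝓞 K), v.asIdeal.ramificationIdxIn (𝓞 L)) with hE
  -- (1) lower genus bound with Chevalley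
  have h1 : E ≤ X * Module.finrank K L * U := finprod_ramificationIdxIn_le hσ
  -- (2) `E > 0` and `p^{mn} ∣ E`
  have hChev := ambiguousClassNumberFormula hσ
  have hEpos : 0 < E := by
    have hF : 0 < Nat.card {c : ClassGroup (𝓞 L) // ∀ τ : L ≃ₐ[K] L, ClassGroup.mulEquiv (intAut τ) c = c} := by
      haveI : Nonempty {c : ClassGroup (𝓞 L) // ∀ τ : L ≃ₐ[K] L, ClassGroup.mulEquiv (intAut τ) c = c} :=
        ⟨⟨1, fun τ => map_one _⟩⟩
      exact Nat.card_pos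
    have hl : 0 < Nat.card {c : ClassGroup (𝓞 L) // ∀ τ : L ≃ₐ[K] L, ClassGroup.mulEquiv (intAut τ) c = c} *
        Module.finrank K L * U := Nat.mul_pos (Nat.mul_pos hF Module.finrank_pos) (Nat.pos_of_ne_zero (relIndex_unitsNorm_ne_zero hσ).1)
    rw [hChev] at hl
    exact Nat.pos_of_mul_pos_left (Nat.pos_of_mul_pos_right hl)
  have h2 : p ^ (m * n) ≤ E := Nat.le_of_dvd hEpos (pow_dvd_finprod_ramificationIdxIn_layer_of_totallyRamifiedFrom κ hram n hm)
  -- (3) `U ≤ p^(n u + log_p #μ)`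
  obtain ⟨k, hk, hkle⟩ := exists_relIndex_map_pow_eq_pow (K := K) (L := L) (p := p) n
  have hU2 : U ≤ p ^ (n * Units.rank K + Nat.log p (Units.torsionOrder K)) := by
    have hdvd : U ∣ ((unitsE L ⊓ (unitsIncl K L).range).map (powMonoidHom (Module.finrank K L))).relIndex
        (unitsE L ⊓ (unitsIncl K L).range) := Subgroup.relIndex_dvd_of_le_left _ map_pow_unitsK_le
    rw [hdeg, hk] at hdvd
    exact (Nat.le_of_dvd (pow_pos hp0 k) hdvd).trans (Nat.pow_le_pow_right hp0 hkle)
  -- (4) `X ≤ (p ^ rank)ⁿ`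
  have hX2 : X ≤ (p ^ classGroupPRank κ n) ^ n := by
    have hN : ∀ b : ClassGroup (𝓞 L), b ^ p ^ n ∈
        (powMonoidHom (Module.finrank K L) : ClassGroup (𝓞 L) →* ClassGroup (𝓞 L)).range ⊔
          ((ClassGroup.mulEquiv (intAut σ)).toMonoidHom / MonoidHom.id (ClassGroup (𝓞 L))).range := fun b =>
      Subgroup.mem_sup_left ⟨b, by rw [powMonoidHom_apply, hdeg]⟩
    have h := card_quotient_le_index_range_pow_pow _ p n hN
    rw [index_range_pow_layer_eq_prime_pow κ n] at h
    exact h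
  -- (5) assemble
  have h5 : p ^ (m * n) ≤ p ^ (n * classGroupPRank κ n + (n + n * Units.rank K + Nat.log p (Units.torsionOrder K))) := by
    calc p ^ (m * n) ≤ E := h2
      _ ≤ X * Module.finrank K L * U := h1
      _ ≤ (p ^ classGroupPRank κ n) ^ n * p ^ n * p ^ (n * Units.rank K + Nat.log p (Units.torsionOrder K)) := by
          rw [hdeg]; exact Nat.mul_le_mul (Nat.mul_le_mul_right _ hX2) hU2
      _ = p ^ (n * classGroupPRank κ n + (n + n * Units.rank K + Nat.log p (Units.torsionOrder K))) := by
          rw [← pow_mul, ← pow_add, ← pow_add]; ring_nf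
  exact (Nat.pow_le_pow_iff_right hp1).mp h5

/-- **Reading for deep layers**: if `log_p #μ(K) ≤ c` and `n ≥ c + 1`, then `m ≤ rank_p Cl(K_n) + 1 + u_K` — i.e. `rank_p Cl(K_n) ≥ m − 1 − u_K` at every layer
`n > log_p #μ(K)` (for `p` odd and `ζ_p ∉ K`: `c = 0`, every `n ≥ 1`). [cite: Gras2003, IV.4] [cite: Washington1997, §13.3 Prop. 13.22–13.23] -/
theorem le_classGroupPRank_layer_add_of_log_le (κ : ZpExtension K p) (hram : TotallyRamifiedFrom κ 0) {c n m : ℕ}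
    (hc : Nat.log p (Units.torsionOrder K) ≤ c) (hn : c + 1 ≤ n)
    (hm : haveI : FiniteDimensional K (κ.layer n) := κ.finiteDimensional_layer_holds n
      m ≤ {w : HeightOneSpectrum (𝓞 K) | w.asIdeal.ramificationIdxIn (𝓞 (κ.layer n)) ≠ 1}.ncard) :
    m ≤ classGroupPRank κ n + 1 + Units.rank K := by
  have h := mul_le_mul_classGroupPRank_layer_add_of_totallyRamifiedFrom κ hram n hm
  by_contra hlt
  have hle : (classGroupPRank κ n + Units.rank K + 2) * n ≤ m * n := Nat.mul_le_mul_right n (by omega)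
  have hexp : (classGroupPRank κ n + Units.rank K + 2) * n = n * classGroupPRank κ n + n * Units.rank K + 2 * n := by ring
  omega

/-- **Reading at an arbitrary layer `n ≥ 1`**: `m ≤ rank_p Cl(K_n) + 1 + u_K + log_p #μ(K)` (crude: `log_p #μ / n ≤ log_p #μ`).
[cite: Gras2003, IV.4] [cite: Lang1990, Ch. 13 §4, Lemma 4.1–4.2] -/
theorem le_classGroupPRank_layer_add_log (κ : ZpExtension K p) (hram : TotallyRamifiedFrom κ 0) {n m : ℕ} (hn : 1 ≤ n)
    (hm : haveI : FiniteDimensional K (κ.layer n) := κ.finiteDimensional_layer_holds n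
      m ≤ {w : HeightOneSpectrum (𝓞 K) | w.asIdeal.ramificationIdxIn (𝓞 (κ.layer n)) ≠ 1}.ncard) :
    m ≤ classGroupPRank κ n + 1 + Units.rank K + Nat.log p (Units.torsionOrder K) := by
  have h := mul_le_mul_classGroupPRank_layer_add_of_totallyRamifiedFrom κ hram n hm
  by_contra hlt
  have hle : (classGroupPRank κ n + 1 + Units.rank K + Nat.log p (Units.torsionOrder K) + 1) * n ≤ m * n :=
    Nat.mul_le_mul_right n (by omega)
  have hexp : (classGroupPRank κ n + 1 + Units.rank K + Nat.log p (Units.torsionOrder K) + 1) * n =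
      n * classGroupPRank κ n + n + n * Units.rank K + n * Nat.log p (Units.torsionOrder K) + n := by ring
  have hlog : Nat.log p (Units.torsionOrder K) ≤ n * Nat.log p (Units.torsionOrder K) := Nat.le_mul_of_pos_left _ (by omega)
  omega

end Summit.BirchSwinnertonDyer.BirchSwinnertonDyer.Theorems.AlignedTransportAtTwoZpTowerRankAnyPrime
end
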